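import Mathlib
import Summits.NavierStokesRegularity.NavierStokesRegularity.Theorems.FilamentSkeletonRssStadiumTangentDeviation
import Summits.NavierStokesRegularity.NavierStokesRegularity.Theorems.FilamentSkeletonRssStadiumBilinearUnitSpeed

/-!
# The `1/7`-disc deviation package at a stadium point (`TangentSkeletonNearStraightL`, stmt-NavierStokesRegularity-23320, registered stub
# `stub_stripPropagation` — the inputs `ρ, e, q` of `Theorems.StadiumSegmentPositivity` in the stub's own terms)

Setting of the stub: the rectangle stadium `S = {z | |Im z| < hs ∧ |Re z − cc| < L + hs}` (`hs = cs√Γ`, `L = Rb√(Γ log Γ)`), a curve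
`F : ℂ → ℂ³` holomorphic on `S`, equal to the complexified real curve `cplx ∘ X` on the real trace, `‖F′‖ ≤ M` on `S` (`M = 2`), `X` differentiable.
At a point `x + it`, `0 < t`, whose SEVENFOLD discs fit (`7t < hs`, `|x − cc| + 7t < L + hs` — automatic on the `hs/8`-stadium around the same
segment, plateau AND end staircase), the shrinking discs `closedBall (x+iu) (7t−u)`, `0 ≤ u ≤ t`, lie in `S` (`closedBall_subset_stadium`), so
`Theorems.StadiumTangentDeviation` gives, with the universal constants `log(7/6)` and `log(7/6) − 1/7`:
* `deviation_seven` : `‖F′(x+it) − F′(x)‖ ≤ M·log(7/6)` and `|Re F′ᵢ(x+it) − Re F′ᵢ(x)| ≤ 2M(log(7/6) − 1/7)`;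
* `euclid_im_le` / `euclid_re_dev_le` : the Euclidean forms `√Σ (Im F′ᵢ(x+it))² ≤ √3·M·log(7/6)`,
  `√Σ (Re F′ᵢ(x+it) − X′ᵢ(x))² ≤ √3·2M(log(7/6) − 1/7)` with `X′ᵢ(x) = ⟪X′(x), eᵢ⟫ = F′ᵢ(x)` real (`Theorems.StadiumBilinearUnitSpeed.deriv_eq_tangent_of_eqOn_real`);
* `sum_sq_coord_eq_norm_sq`, `sqrt_sum_sq_coord_sub` : `Σ ⟪v,eᵢ⟫² = ‖v‖²`, so unit speed gives `Σ X′ᵢ² = 1` and the tangent oscillation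
  `‖X′(x) − X′(x′)‖ ≤ Rb` is the `ρ` of the segment lemma;
* `log_seven_sixths_le` : `log(7/6) ≤ 1/6` (so with `M = 2`: `q ≤ √3/3 < 0.578`, `e ≤ √3·4·(1/6 − 1/7) < 0.165`).
HONEST FRAMING: a tool for a HYPOTHETICAL filament skeleton on the NEGATIVE side of a MODEL route; nothing here bears on Navier–Stokes regularity or
blow-up.  `--supports stmt-NavierStokesRegularity-23320`.
-/

set_option linter.dupNamespace false

noncomputable section

namespace Summit.NavierStokesRegularity.NavierStokesRegularity.Theorems.StadiumDeviationPackage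

open Set Metric
open scoped InnerProductSpace
open Summit.NavierStokesRegularity.NavierStokesRegularity.Theorems.StadiumTangentDeviation
open Summit.NavierStokesRegularity.NavierStokesRegularity.Theorems.StadiumBilinearUnitSpeed

/-- `log(7/6) ≤ 1/6`. [folklore] -/
theorem log_seven_sixths_le : Real.log (7 / 6) ≤ 1 / 6 := by
  have := Real.log_le_sub_one_of_pos (show (0:ℝ) < 7 / 6 by norm_num); linarith

/-- `0 < log(7/6) − 1/7` is not needed; we record `0 ≤ log(7/6) − 1/7` (from `1 − 1/x ≤ log x`). [folklore] -/
theorem log_seven_sixths_sub_nonneg : 0 ≤ Real.log (7 / 6) - 1 / 7 := by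
  have h := Real.one_sub_inv_le_log_of_pos (show (0:ℝ) < 7 / 6 by norm_num)
  norm_num at h ⊢; linarith

/-- Coordinates against the standard basis: `⟪v, eᵢ⟫ = vᵢ`. [folklore] -/
theorem inner_single_eq (v : EuclideanSpace ℝ (Fin 3)) (i : Fin 3) : ⟪v, EuclideanSpace.single i (1:ℝ)⟫_ℝ = v i := by
  rw [EuclideanSpace.inner_single_right]; simp

/-- `Σᵢ ⟪v, eᵢ⟫² = ‖v‖²`. [folklore] -/
theorem sum_sq_coord_eq_norm_sq (v : EuclideanSpace ℝ (Fin 3)) : ∑ i, ⟪v, EuclideanSpace.single i (1:ℝ)⟫_ℝ ^ 2 = ‖v‖ ^ 2 := by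
  simp only [inner_single_eq]
  rw [EuclideanSpace.norm_eq, Real.sq_sqrt (Finset.sum_nonneg fun i _ => sq_nonneg _)]
  simp [Real.norm_eq_abs, sq_abs]

/-- `√(Σᵢ (⟪v, eᵢ⟫ − ⟪w, eᵢ⟫)²) = ‖v − w‖` — the tangent oscillation in coordinates. [folklore] -/
theorem sqrt_sum_sq_coord_sub (v w : EuclideanSpace ℝ (Fin 3)) :
    √(∑ i, (⟪v, EuclideanSpace.single i (1:ℝ)⟫_ℝ - ⟪w, EuclideanSpace.single i (1:ℝ)⟫_ℝ) ^ 2) = ‖v - w‖ := by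
  have h : ∀ i, ⟪v, EuclideanSpace.single i (1:ℝ)⟫_ℝ - ⟪w, EuclideanSpace.single i (1:ℝ)⟫_ℝ =
      ⟪v - w, EuclideanSpace.single i (1:ℝ)⟫_ℝ := fun i => by rw [inner_sub_left]
  simp only [h, sum_sq_coord_eq_norm_sq]
  exact Real.sqrt_sq (norm_nonneg _)

/-- The sevenfold shrinking discs fit in the rectangle stadium. [folklore] -/
theorem closedBall_subset_stadium {hs L cc x u r : ℝ} (hu : 0 ≤ u) (h1 : u + r < hs)
    (h2 : |x - cc| + r < L + hs) :
    closedBall ((x : ℂ) + (u : ℂ) * Complex.I) r ⊆ {z : ℂ | |z.im| < hs ∧ |z.re - cc| < L + hs} := by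
  intro w hw
  rw [mem_closedBall, dist_eq_norm] at hw
  have him : |w.im - u| ≤ r := by
    have h := Complex.abs_im_le_norm (w - ((x : ℂ) + (u : ℂ) * Complex.I))
    have e : (w - ((x : ℂ) + (u : ℂ) * Complex.I)).im = w.im - u := by simp
    rw [e] at h; exact h.trans hw
  have hre : |w.re - x| ≤ r := by
    have h := Complex.abs_re_le_norm (w - ((x : ℂ) + (u : ℂ) * Complex.I))
    have e : (w - ((x : ℂ) + (u : ℂ) * Complex.I)).re = w.re - x := by simp
    rw [e] at h; exact h.trans hw
  refine ⟨?_, ?_⟩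
  · rw [abs_lt]; rw [abs_le] at him; constructor <;> linarith
  · have : |w.re - cc| ≤ |w.re - x| + |x - cc| := by
      have := abs_add_le (w.re - x) (x - cc)
      have e : w.re - x + (x - cc) = w.re - cc := by ring
      rw [e] at this; exact this
    linarith

/-- **The `1/7`-disc deviation bounds at a stadium point.**  See the module docstring. [folklore] -/
theorem deviation_seven {hs L cc M : ℝ} {F : ℂ → (Fin 3 → ℂ)}
    (hF : DifferentiableOn ℂ F {z : ℂ | |z.im| < hs ∧ |z.re - cc| < L + hs})
    (hM : ∀ z ∈ {z : ℂ | |z.im| < hs ∧ |z.re - cc| < L + hs}, ‖deriv F z‖ ≤ M)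
    {X : ℝ → EuclideanSpace ℝ (Fin 3)}
    (hFX : ∀ r : ℝ, (r : ℂ) ∈ {z : ℂ | |z.im| < hs ∧ |z.re - cc| < L + hs} →
      F r = fun i => ((⟪X r, EuclideanSpace.single i (1:ℝ)⟫_ℝ : ℝ) : ℂ))
    {x t : ℝ} (ht : 0 < t) (h7 : 7 * t < hs) (h7' : |x - cc| + 7 * t < L + hs) (i : Fin 3) :
    ‖deriv F ((x : ℂ) + (t : ℂ) * Complex.I) - deriv F (x : ℂ)‖ ≤ M * Real.log (7 / 6) ∧
    |(deriv F ((x : ℂ) + (t : ℂ) * Complex.I) i).re - (deriv F (x : ℂ) i).re| ≤ 2 * M * (Real.log (7 / 6) - 1 / 7) := by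
  set S : Set ℂ := {z : ℂ | |z.im| < hs ∧ |z.re - cc| < L + hs} with hS
  have hSo : IsOpen S := by
    have h1 : IsOpen {z : ℂ | |z.im| < hs} := isOpen_lt (continuous_abs.comp Complex.continuous_im) continuous_const
    have h2 : IsOpen {z : ℂ | |z.re - cc| < L + hs} :=
      isOpen_lt (continuous_abs.comp (Complex.continuous_re.sub continuous_const)) continuous_const
    exact h1.inter h2
  have hhs : 0 < hs := by linarith
  have hdisc : ∀ u ∈ Icc (0:ℝ) t, closedBall ((x : ℂ) + (u : ℂ) * Complex.I) (7 * t - u) ⊆ S := by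
    intro u hu
    exact closedBall_subset_stadium hu.1 (by linarith) (by linarith [hu.1])
  have htR : t < 7 * t := by linarith
  have hlog : Real.log (7 * t / (7 * t - t)) = Real.log (7 / 6) := by
    congr 1; field_simp; ring
  have hrat : t / (7 * t) = 1 / 7 := by field_simp
  refine ⟨?_, ?_⟩
  · have h := norm_deriv_vertical_sub_le hSo hF hM ht.le htR hdisc
    rwa [hlog] at h
  · -- the real trace of the stadium, an interval around `x`
    have hxS : |x - cc| < L + hs := by linarith
    have hab : ∀ r ∈ Ioo (cc - (L + hs)) (cc + (L + hs)), (r : ℂ) ∈ S := by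
      intro r hr
      refine ⟨by simpa using hhs, ?_⟩
      simp only [Complex.ofReal_re]
      rw [abs_lt]; constructor <;> linarith [hr.1, hr.2]
    have hx : x ∈ Ioo (cc - (L + hs)) (cc + (L + hs)) := by
      rw [abs_lt] at hxS; constructor <;> linarith
    have hreal : ∀ r ∈ Ioo (cc - (L + hs)) (cc + (L + hs)), ∀ i, (F r i).im = 0 := by
      intro r hr j
      rw [hFX r (hab r hr)]
      exact Complex.ofReal_im _
    have h := abs_re_deriv_vertical_sub_le hSo hF hM hx hab hreal ht.le htR hdisc i
    rwa [hlog, hrat] at h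

/-- **The real tangent at a real stadium point**: `F′(x) = cplx(X′(x))`, so `Re F′ᵢ(x) = ⟪X′(x), eᵢ⟫` and `Im F′ᵢ(x) = 0`. [folklore] -/
theorem deriv_real_point {hs L cc : ℝ} {F : ℂ → (Fin 3 → ℂ)}
    (hF : DifferentiableOn ℂ F {z : ℂ | |z.im| < hs ∧ |z.re - cc| < L + hs})
    {X : ℝ → EuclideanSpace ℝ (Fin 3)} (hX : Differentiable ℝ X)
    (hFX : ∀ r : ℝ, (r : ℂ) ∈ {z : ℂ | |z.im| < hs ∧ |z.re - cc| < L + hs} →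
      F r = fun i => ((⟪X r, EuclideanSpace.single i (1:ℝ)⟫_ℝ : ℝ) : ℂ))
    {x : ℝ} (hhs : 0 < hs) (hx : |x - cc| < L + hs) (i : Fin 3) :
    (deriv F (x : ℂ) i).re = ⟪deriv X x, EuclideanSpace.single i (1:ℝ)⟫_ℝ ∧ (deriv F (x : ℂ) i).im = 0 := by
  set S : Set ℂ := {z : ℂ | |z.im| < hs ∧ |z.re - cc| < L + hs} with hS
  have hSo : IsOpen S := by
    have h1 : IsOpen {z : ℂ | |z.im| < hs} := isOpen_lt (continuous_abs.comp Complex.continuous_im) continuous_const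
    have h2 : IsOpen {z : ℂ | |z.re - cc| < L + hs} :=
      isOpen_lt (continuous_abs.comp (Complex.continuous_re.sub continuous_const)) continuous_const
    exact h1.inter h2
  -- a closed interval `[x − ε, x + ε]` inside the real trace
  obtain ⟨ε, hε, hεx⟩ : ∃ ε : ℝ, 0 < ε ∧ |x - cc| + ε < L + hs := ⟨(L + hs - |x - cc|) / 2, by linarith, by linarith⟩
  have hsub : ∀ r : ℝ, r ∈ Icc (x - ε) (x + ε) → (r : ℂ) ∈ S := by
    intro r hr
    refine ⟨by simpa using hhs, ?_⟩
    simp only [Complex.ofReal_re]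
    have : |r - x| ≤ ε := abs_le.2 ⟨by linarith [hr.1], by linarith [hr.2]⟩
    calc |r - cc| ≤ |r - x| + |x - cc| := by
          have := abs_add_le (r - x) (x - cc)
          have e : r - x + (x - cc) = r - cc := by ring
          rw [e] at this; exact this
      _ < L + hs := by linarith
  have h := deriv_eq_tangent_of_eqOn_real hSo hF hsub (fun r hr => hFX r (hsub r hr)) (fun r _ => (hX r)) x
    ⟨by linarith, by linarith⟩
  rw [h]
  exact ⟨Complex.ofReal_re _, Complex.ofReal_im _⟩

/-- **Euclidean imaginary deviation**: `√Σ (Im F′ᵢ(x+it))² ≤ √3·M·log(7/6)`. [folklore] -/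
theorem euclid_im_le {hs L cc M : ℝ} {F : ℂ → (Fin 3 → ℂ)}
    (hF : DifferentiableOn ℂ F {z : ℂ | |z.im| < hs ∧ |z.re - cc| < L + hs})
    (hM : ∀ z ∈ {z : ℂ | |z.im| < hs ∧ |z.re - cc| < L + hs}, ‖deriv F z‖ ≤ M)
    {X : ℝ → EuclideanSpace ℝ (Fin 3)} (hX : Differentiable ℝ X)
    (hFX : ∀ r : ℝ, (r : ℂ) ∈ {z : ℂ | |z.im| < hs ∧ |z.re - cc| < L + hs} →
      F r = fun i => ((⟪X r, EuclideanSpace.single i (1:ℝ)⟫_ℝ : ℝ) : ℂ))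
    {x t : ℝ} (ht : 0 < t) (h7 : 7 * t < hs) (h7' : |x - cc| + 7 * t < L + hs) :
    √(∑ i, (deriv F ((x : ℂ) + (t : ℂ) * Complex.I) i).im ^ 2) ≤ √3 * (M * Real.log (7 / 6)) := by
  have hhs : 0 < hs := by linarith
  have hx : |x - cc| < L + hs := by linarith
  have hcomp : ∀ i, |(deriv F ((x : ℂ) + (t : ℂ) * Complex.I) i).im| ≤ M * Real.log (7 / 6) := by
    intro i
    have h1 := (deviation_seven hF hM hFX ht h7 h7' i).1
    have h0 := (deriv_real_point hF hX hFX hhs hx i).2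
    have e : (deriv F ((x : ℂ) + (t : ℂ) * Complex.I) i).im =
        ((deriv F ((x : ℂ) + (t : ℂ) * Complex.I) - deriv F (x : ℂ)) i).im := by
      simp [Pi.sub_apply, Complex.sub_im, h0]
    rw [e]
    exact ((Complex.abs_im_le_norm _).trans (norm_le_pi_norm _ i)).trans h1
  have hM0 : 0 ≤ M * Real.log (7 / 6) := (abs_nonneg _).trans (hcomp 0)
  have hsum : ∑ i, (deriv F ((x : ℂ) + (t : ℂ) * Complex.I) i).im ^ 2 ≤ 3 * (M * Real.log (7 / 6)) ^ 2 :=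
    calc ∑ i, (deriv F ((x : ℂ) + (t : ℂ) * Complex.I) i).im ^ 2 ≤ ∑ _i : Fin 3, (M * Real.log (7 / 6)) ^ 2 :=
          Finset.sum_le_sum fun i _ => sq_le_sq' (by linarith [neg_abs_le ((deriv F ((x : ℂ) + (t : ℂ) * Complex.I) i).im), hcomp i])
            ((le_abs_self _).trans (hcomp i))
      _ = 3 * (M * Real.log (7 / 6)) ^ 2 := by simp
  calc √(∑ i, (deriv F ((x : ℂ) + (t : ℂ) * Complex.I) i).im ^ 2) ≤ √(3 * (M * Real.log (7 / 6)) ^ 2) := Real.sqrt_le_sqrt hsum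
    _ = √3 * (M * Real.log (7 / 6)) := by
        rw [Real.sqrt_mul (by norm_num), Real.sqrt_sq hM0]

/-- **Euclidean real-part deviation from the real tangent**: `√Σ (Re F′ᵢ(x+it) − ⟪X′(x), eᵢ⟫)² ≤ √3·2M(log(7/6) − 1/7)`. [folklore] -/
theorem euclid_re_dev_le {hs L cc M : ℝ} {F : ℂ → (Fin 3 → ℂ)}
    (hF : DifferentiableOn ℂ F {z : ℂ | |z.im| < hs ∧ |z.re - cc| < L + hs})
    (hM : ∀ z ∈ {z : ℂ | |z.im| < hs ∧ |z.re - cc| < L + hs}, ‖deriv F z‖ ≤ M)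
    {X : ℝ → EuclideanSpace ℝ (Fin 3)} (hX : Differentiable ℝ X)
    (hFX : ∀ r : ℝ, (r : ℂ) ∈ {z : ℂ | |z.im| < hs ∧ |z.re - cc| < L + hs} →
      F r = fun i => ((⟪X r, EuclideanSpace.single i (1:ℝ)⟫_ℝ : ℝ) : ℂ))
    {x t : ℝ} (ht : 0 < t) (h7 : 7 * t < hs) (h7' : |x - cc| + 7 * t < L + hs) :
    √(∑ i, ((deriv F ((x : ℂ) + (t : ℂ) * Complex.I) i).re - ⟪deriv X x, EuclideanSpace.single i (1:ℝ)⟫_ℝ) ^ 2) ≤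
      √3 * (2 * M * (Real.log (7 / 6) - 1 / 7)) := by
  have hhs : 0 < hs := by linarith
  have hx : |x - cc| < L + hs := by linarith
  have hcomp : ∀ i, |(deriv F ((x : ℂ) + (t : ℂ) * Complex.I) i).re - ⟪deriv X x, EuclideanSpace.single i (1:ℝ)⟫_ℝ| ≤
      2 * M * (Real.log (7 / 6) - 1 / 7) := by
    intro i
    have h1 := (deviation_seven hF hM hFX ht h7 h7' i).2
    have h0 := (deriv_real_point hF hX hFX hhs hx i).1
    rw [← h0]; exact h1
  have hM0 : 0 ≤ 2 * M * (Real.log (7 / 6) - 1 / 7) := (abs_nonneg _).trans (hcomp 0)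
  have hsum : ∑ i, ((deriv F ((x : ℂ) + (t : ℂ) * Complex.I) i).re - ⟪deriv X x, EuclideanSpace.single i (1:ℝ)⟫_ℝ) ^ 2 ≤
      3 * (2 * M * (Real.log (7 / 6) - 1 / 7)) ^ 2 :=
    calc ∑ i, ((deriv F ((x : ℂ) + (t : ℂ) * Complex.I) i).re - ⟪deriv X x, EuclideanSpace.single i (1:ℝ)⟫_ℝ) ^ 2
          ≤ ∑ _i : Fin 3, (2 * M * (Real.log (7 / 6) - 1 / 7)) ^ 2 :=
          Finset.sum_le_sum fun i _ => sq_le_sq'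
            (by linarith [neg_abs_le ((deriv F ((x : ℂ) + (t : ℂ) * Complex.I) i).re - ⟪deriv X x, EuclideanSpace.single i (1:ℝ)⟫_ℝ), hcomp i])
            ((le_abs_self _).trans (hcomp i))
      _ = 3 * (2 * M * (Real.log (7 / 6) - 1 / 7)) ^ 2 := by simp
  calc √(∑ i, ((deriv F ((x : ℂ) + (t : ℂ) * Complex.I) i).re - ⟪deriv X x, EuclideanSpace.single i (1:ℝ)⟫_ℝ) ^ 2)
        ≤ √(3 * (2 * M * (Real.log (7 / 6) - 1 / 7)) ^ 2) := Real.sqrt_le_sqrt hsum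
    _ = √3 * (2 * M * (Real.log (7 / 6) - 1 / 7)) := by
        rw [Real.sqrt_mul (by norm_num), Real.sqrt_sq hM0]

/-- **Unit real tangent in coordinates**: `Σ ⟪X′(x), eᵢ⟫² = 1` when `‖X′(x)‖ = 1`, and the oscillation `√Σ(⟪X′(x),eᵢ⟫ − ⟪X′(x′),eᵢ⟫)² ≤ Rb`
when `‖X′(x) − X′(x′)‖ ≤ Rb` — the hypotheses `hT`, `hρ` of `Theorems.StadiumSegmentPositivity.segment_chord_re_ge`. [folklore] -/
theorem unit_tangent_coords {X : ℝ → EuclideanSpace ℝ (Fin 3)} (hunit : ∀ τ, ‖deriv X τ‖ = 1) {Rb : ℝ}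
    (hosc : ∀ τ σ, ‖deriv X τ - deriv X σ‖ ≤ Rb) (x x' : ℝ) :
    ∑ i, ⟪deriv X x, EuclideanSpace.single i (1:ℝ)⟫_ℝ ^ 2 = 1 ∧
    √(∑ i, (⟪deriv X x, EuclideanSpace.single i (1:ℝ)⟫_ℝ - ⟪deriv X x', EuclideanSpace.single i (1:ℝ)⟫_ℝ) ^ 2) ≤ Rb := by
  refine ⟨?_, ?_⟩
  · rw [sum_sq_coord_eq_norm_sq, hunit x]; norm_num
  · rw [sqrt_sum_sq_coord_sub]; exact hosc x x'

end Summit.NavierStokesRegularity.NavierStokesRegularity.Theorems.StadiumDeviationPackage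

end
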